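import Summits.NavierStokesRegularity.NavierStokesRegularity.Theses.TypeILiouville
import Literature.Analysis.FluidPDE.AncientMildGaugeFixing
import Summits.NavierStokesRegularity.NavierStokesRegularity.Theorems.TypeILiouvilleTypeIliouvilleLStubWeakAncientDriftMild
import Summits.NavierStokesRegularity.NavierStokesRegularity.Theorems.TypeILiouvilleTypeIliouvilleLStubDriftMildAncientOseen
import Summits.NavierStokesRegularity.NavierStokesRegularity.Theorems.TypeILiouvilleTypeIliouvilleLStubOseenBallAverageMomentum
import Summits.NavierStokesRegularity.NavierStokesRegularity.Theorems.TypeILiouvilleTypeIliouvilleLStubOseenGaugeUniformEverySlice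
import Mathlib.MeasureTheory.Integral.Average
import HarnessLib

/-!
# The Oseen gauge theorem for bounded ancient mild solutions (crux `TypeIliouvilleL`,
# stmt-NavierStokesRegularity-10661, line `registered`)

Support file for the crux `TypeIliouvilleL` (= the Liouville conjecture (L) of
Koch–Nadirashvili–Seregin–Šverák 2009 over the tree's duality-form class
`Literature.Analysis.FluidPDE.IsBoundedAncientMildSolution`). It assembles the four landed stubs of
the line — KNSS's Lemma 3.1 along `(−∞, 0)` (`stub_weak_ancient_driftMild`), Galilean covariance
(`stub_driftMild_ancient_oseen`), conservation of momentum at spatial infinity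
(`stub_oseen_ball_average_momentum`) and the uniform bound / every-slice upgrade
(`stub_oseen_gauge_uniform_every_slice`) — into the structural theorem that identifies the
tree's class with print's:

* `oseen_gauge_of_stronglyMeasurable` — every bounded ancient mild solution (`ν = 1`, duality
  form) which is **jointly strongly measurable** on `ℝ × ℝ³` (equivalently, by
  `IsBoundedAncientMildSolution.isBoundedWeakNSSolutionOn`, a bounded weak solution of
  Navier–Stokes on `ℝ³ × (−∞,0)` in the sense of KNSS 2009 §4 (ii)) is, at EVERY `t < 0` and a.e.
  in space, the Galilean image `x ↦ v(t, x − A(t)) + c(t)` of ONE field `v` which is jointly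
  measurable, continuous and **uniformly bounded** on `(−∞,0) × ℝ³`, weakly divergence free on
  every slice, and solves the Oseen integral equation `v(t) = e^{(t−s)Δ}v(s) − B¹_s(v,v)(t)` for
  all `s < t < 0` — i.e. a bounded ancient mild solution in the sense of KNSS 2009 §4 (i), the
  class of Albritton–Barker 2019, Thm 1.2 and of the Type-I Liouville items of the routes
  `SymmetryModuliCount` / `ExtremalTypeIConstant`; the frame path `A` is continuous;
* `oseen_gauge_of_aestronglyMeasurable` — the same for the full slice-wise class of the crux
  (a.e.-strongly measurable slices), through the landed gauge fixing theorem
  `IsBoundedAncientMildSolution.exists_stronglyMeasurable_gauge` (the slice-wise class differs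
  from print's only by bounded spatial constants `d(t)`, absorbed into `c(t)`).

This is the sense in which the parasitic drift `b(t)` of KNSS 2009 §1 p. 3 is the ONLY
difference between bounded weak and bounded mild ancient solutions, with the new analytic input
that the co-moving mild representative is uniformly bounded (the mean at infinity of a bounded
Oseen-mild field does not move, so the drift has oscillation `≤ 2‖u‖_∞` over all of `(−∞,0)`).

## References

* G. Koch, N. Nadirashvili, G. Seregin, V. Šverák, *Liouville theorems for the Navier–Stokes
  equations and applications*, Acta Math. 203 (2009) 83–105 = arXiv:0709.3599, §1 p. 3
  (parasitic solutions, Galilean frames), §3 Lemma 3.1 and Remark 3.1, §4 (i)–(ii).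
  [KochNadirashviliSereginSverak2009]
* D. Albritton, T. Barker, J. Math. Fluid Mech. 21 (2019) = arXiv:1811.00502, §1 (the class of
  mild bounded ancient solutions). [AlbrittonBarker2019]
-/

-- the summit and its single problem share the name (D-0017 nested layout)
set_option linter.dupNamespace false

noncomputable section

open MeasureTheory Filter Set Function Metric
open scoped Topology ENNReal

namespace Summit.NavierStokesRegularity.NavierStokesRegularity.Theorems

/-- **The Oseen gauge theorem for print's class.** Every bounded ancient mild solution of
Navier–Stokes (`ν = 1`, duality form) on `ℝ³ × (−∞,0)` which is jointly strongly measurable is,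
at every `t < 0` and a.e. in space, `x ↦ v(t, x − A(t)) + c(t)` for one field `v` which is jointly
measurable, continuous and uniformly bounded on `(−∞,0) × ℝ³`, weakly divergence free on every
slice, and solves the Oseen integral equation for all `s < t < 0`; the frame path `A` is
continuous. Composition of the landed stubs A (`stub_weak_ancient_driftMild`: `u = U + b(t)`,
`(U, b)` ancient drift-mild), B (`stub_driftMild_ancient_oseen`: `V(t, y) = U(t, y + A(t))`
solves the Oseen equation), C (`stub_oseen_ball_average_momentum`: `⨍_{B_R}(V(t) − V(s)) → 0`)
and DE (`stub_oseen_gauge_uniform_every_slice`: one bound for `V`, the representation at every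
slice modulo constants). -/
theorem oseen_gauge_of_stronglyMeasurable :
    ∀ u : ℝ → EuclideanSpace ℝ (Fin 3) → EuclideanSpace ℝ (Fin 3),
      Literature.Analysis.FluidPDE.IsBoundedAncientMildSolution 1 u →
      StronglyMeasurable (uncurry u) →
      ∃ (v : ℝ → EuclideanSpace ℝ (Fin 3) → EuclideanSpace ℝ (Fin 3))
        (A c : ℝ → EuclideanSpace ℝ (Fin 3)),
        Measurable (uncurry v) ∧ ContinuousOn (uncurry v) (Iio 0 ×ˢ univ) ∧
        (∃ K : ℝ, ∀ t < 0, ∀ x, ‖v t x‖ ≤ K) ∧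
        (∀ t < 0, Literature.Analysis.FluidPDE.IsWeaklyDivFree (v t)) ∧
        (∀ s t : ℝ, s < t → t < 0 → ∀ x,
          v t x = Literature.Analysis.UnboundedOperators.heatExtension (v s) (t - s) x -
            Literature.Analysis.FluidPDE.oseenDuhamel 1 s v v t x) ∧
        Continuous A ∧
        ∀ t < 0, u t =ᵐ[volume] fun x => v t (x - A t) + c t := by
  intro u hu hj
  obtain ⟨U, b, hUm, hbm, hUc, hloc, hUdiv, hUmild, hrepU⟩ := stub_weak_ancient_driftMild u hu hj
  obtain ⟨A, hAc, hVm, hVc, hVmild⟩ := stub_driftMild_ancient_oseen U b hUm hbm hUc hloc hUdiv hUmild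
  set V : ℝ → EuclideanSpace ℝ (Fin 3) → EuclideanSpace ℝ (Fin 3) := fun t y => U t (y + A t)
    with hV_def
  have hVdiv : ∀ t < 0, Literature.Analysis.FluidPDE.IsWeaklyDivFree (V t) := fun t ht =>
    (hUdiv t ht).comp_add_right' (A t)
  have hVmild' : ∀ s t : ℝ, s < t → t < 0 → ∀ y,
      V t y = Literature.Analysis.UnboundedOperators.heatExtension (V s) (t - s) y -
        Literature.Analysis.FluidPDE.oseenDuhamel 1 s V V t y :=
    fun s t hst ht y => hVmild s t hst ht y
  -- conservation of momentum for `V`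
  have hmom : ∀ s t : ℝ, s < t → t < 0 →
      Tendsto (fun R : ℝ => ⨍ y in Metric.ball (0 : EuclideanSpace ℝ (Fin 3)) R, (V t y - V s y))
        atTop (𝓝 0) := by
    intro s t hst ht
    obtain ⟨N, hN, -⟩ := hloc (s - 1) (by linarith)
    have hb : ∀ σ ∈ Icc s t, ∀ y, ‖V σ y‖ ≤ N := fun σ hσ y =>
      hN σ ⟨by linarith [hσ.1], hσ.2.trans_lt ht⟩ (y + A σ)
    have key := stub_oseen_ball_average_momentum V N s t hst hVm hb
    have heq : (fun R : ℝ => ⨍ y in Metric.ball (0 : EuclideanSpace ℝ (Fin 3)) R, (V t y - V s y)) =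
        fun R : ℝ => ⨍ y in Metric.ball (0 : EuclideanSpace ℝ (Fin 3)) R,
          (Literature.Analysis.UnboundedOperators.heatExtension (V s) (t - s) y - V s y -
            Literature.Analysis.FluidPDE.oseenDuhamel 1 s V V t y) := by
      funext R
      congr 1
      funext y
      rw [hVmild' s t hst ht y]
      abel
    rw [heq]
    exact key
  -- the a.e.-in-time representation through `V`
  have hrepV : ∀ᵐ t ∂(volume.restrict (Iio (0 : ℝ))),
      u t =ᵐ[volume] fun x => V t (x - A t) + b t := by
    filter_upwards [hrepU] with t ht
    refine ht.trans (Eventually.of_forall fun x => ?_)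
    simp only [hV_def, sub_add_cancel]
  have hslice : ∀ t < 0, AEStronglyMeasurable (u t) volume := fun t _ =>
    (hj.comp_measurable measurable_prodMk_left).aestronglyMeasurable
  obtain ⟨⟨K, hK⟩, c, hc⟩ :=
    stub_oseen_gauge_uniform_every_slice u V A b hu hslice hAc hVc hVdiv hmom hrepV
  exact ⟨V, A, c, hVm, hVc, ⟨K, hK⟩, hVdiv, hVmild', hAc, hc⟩

/-- **The Oseen gauge theorem for the slice-wise class of the crux.** Every bounded ancient mild
solution of Navier–Stokes (`ν = 1`, duality form) on `ℝ³ × (−∞,0)` with a.e.-strongly measurable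
slices is, at every `t < 0` and a.e. in space, `x ↦ v(t, x − A(t)) + c(t)` for one bounded
continuous ancient solution `v` of the Oseen integral equation as in
`oseen_gauge_of_stronglyMeasurable`. Reduction to print's class by the landed gauge fixing theorem
`Literature.Analysis.FluidPDE.IsBoundedAncientMildSolution.exists_stronglyMeasurable_gauge`: the
member `u` agrees slice-wise a.e., modulo bounded spatial constants `d(t)`, with a jointly
strongly measurable member, and the `d(t)` are absorbed into `c(t)`. -/
theorem oseen_gauge_of_aestronglyMeasurable :
    ∀ u : ℝ → EuclideanSpace ℝ (Fin 3) → EuclideanSpace ℝ (Fin 3),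
      Literature.Analysis.FluidPDE.IsBoundedAncientMildSolution 1 u →
      (∀ t < 0, AEStronglyMeasurable (u t) volume) →
      ∃ (v : ℝ → EuclideanSpace ℝ (Fin 3) → EuclideanSpace ℝ (Fin 3))
        (A c : ℝ → EuclideanSpace ℝ (Fin 3)),
        Measurable (uncurry v) ∧ ContinuousOn (uncurry v) (Iio 0 ×ˢ univ) ∧
        (∃ K : ℝ, ∀ t < 0, ∀ x, ‖v t x‖ ≤ K) ∧
        (∀ t < 0, Literature.Analysis.FluidPDE.IsWeaklyDivFree (v t)) ∧
        (∀ s t : ℝ, s < t → t < 0 → ∀ x,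
          v t x = Literature.Analysis.UnboundedOperators.heatExtension (v s) (t - s) x -
            Literature.Analysis.FluidPDE.oseenDuhamel 1 s v v t x) ∧
        Continuous A ∧
        ∀ t < 0, u t =ᵐ[volume] fun x => v t (x - A t) + c t := by
  intro u hu hmeas
  obtain ⟨w, d, hw, hwj, -, hwu⟩ := hu.exists_stronglyMeasurable_gauge one_pos hmeas
  obtain ⟨v, A, c, hvm, hvc, hvK, hvd, hvmild, hA, hrep⟩ := oseen_gauge_of_stronglyMeasurable w hw hwj
  refine ⟨v, A, fun t => c t - d t, hvm, hvc, hvK, hvd, hvmild, hA, fun t ht => ?_⟩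
  show u t =ᵐ[volume] fun x => v t (x - A t) + (c t - d t)
  filter_upwards [hwu t ht, hrep t ht] with x hx hx'
  have : u t x = w t x - d t := by rw [hx]; abel
  rw [this, hx']
  abel

end Summit.NavierStokesRegularity.NavierStokesRegularity.Theorems
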